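import Summits.BirchSwinnertonDyer.BirchSwinnertonDyer.Theses.PrintX8VS
import Summits.BirchSwinnertonDyer.BirchSwinnertonDyer.Theorems.SignedLowerHalvesSprungLowerDivisibilityAtThreeIotaDoorStubs
import Summits.BirchSwinnertonDyer.BirchSwinnertonDyer.Theorems.SignedLowerHalvesSprungLowerDivisibilityAtThreeCokerBoundByMassPoitouTate
import Literature.NumberTheory.EllipticCurves.Kato2004.IwasawaCohomologyExistsProofs
import HarnessLib

/-!
# Crux `KatoSporadicPosLevelGivenHeldX8C` (item stmt-BirchSwinnertonDyer-23401, route `PrintX8VS` rev 18; the keying-honest guarded child of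
# K1 19875's line `chromatic-common-zeros`) — WHERE THE REGISTERED ι-DOOR SKELETON STANDS: the crux BY NAME from FOUR PRINTED FACTS and the
# residue stub R♮ alone (F-α♮ DISCHARGED by name through w2 g9's by-mass reduction and w3 g9's typed Poitou–Tate functional model)

19875 LEAD seat gen 6 (prover; host `pub/bsd-ssimc`), 2026-08-28. `--supports` 23401 `--as helper`; THEOREMS ONLY; imports the route file
`Theses.PrintX8VS` (the crux decl) — nothing else route-dependent. Closes NOTHING: R♮ stays a displayed hypothesis (OPEN in print) and four
named facts are taken by name. **BSD is NOT proved; K_spor / S4b-cyc / 23401 NOT proved.**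

## What (LEAD bookkeeping, L4: the F-α♮ stub is «print modulo named facts», not input-free)

The skeleton registered on 23401 (`Cruxes.KatoSporadicPosLevelGivenHeldX8C.IotaDoor`, evidence #5) has two stubs: F-α♮ `stub_cokerBoundIotaOffT`
(input-free as registered) and R♮ `stub_katoFineLowerResidueIotaOffTC (h714)(h716c)(h3)`. The width seats settled F-α♮ BY CITATION:
`ChromaticCommonZeros.cokerBoundIotaOffT_of_poitouTate (hPT)(h124)(hI)(hMatar)(hfine)` (w2 g9, `…CokerBoundByMassPoitouTate`) gives the
stub's signature VERBATIM from Sprung's Poitou–Tate functional model (`Sprung2012.thm714seq_sharpFlat_poitouTate_functionalModel`, w3 g9),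
Kato Thm. 12.4 (`Kato2004.thm12_4`), Matar 2020 Thm. 1.1 (`matar2020_thm11_selmerDualTorsion_pseudoIso_fineSelmerDual`), Kato's fine torsion
(`Kato2004_fineSelmerDual_isTorsion`) — and `Kato2004.nonempty_iwasawaH1Data` (PROVED: `…_holds`). None of these four facts is among
23401's three guards, so the registered input-free F-α♮ cannot be CREDITED on the ledger short of proving them (XL); what CAN be landed is this
file's composition: **`KatoSporadicPosLevelGivenHeldX8C_of_printedFacts_of_residue`** —

  `hPT → h124 → hMatar → hfine → (R♮-C body, with its binders h714 h716c h3 supplied by the crux's own guard) → KatoSporadicPosLevelGivenHeldX8C`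

— i.e. the crux BY NAME modulo four PRINTED theorems and the research residue R♮ (Kato 12.10 ⊆ / Sprung 7.21 ⊆ on the loose ι-orbits; OPEN
in print at (3, a₃ = ±3)). For the x8 pen's stage (B): a keying-honest guard pack that also displays {PT functional model, Kato 12.4, Matar
1.1, fine torsion} makes F-α♮ a one-line close and leaves R♮ as the ONLY stub of the C′ K_spor crux. (Per-pair: at coprime cells with a
♭-zero the γ-keyed package is empty under the guard — `…GuardedPackageVacuity`, p668069 — so R♮'s content sits at pairs with no private ♭-zero.)

References: Sprung, JNT 132 (2012) Thm. 7.14 (3), Thm. 7.16, Prop. 7.19, Main Conj. 7.21 [Sprung2012]; Kato, Astérisque 295 Thm. 12.4,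
Conj. 12.10, §17.13 [Kato2004Asterisque]; Matar, Asian J. Math. 24 (2020) Thm. 1.1 [Matar2020]; Wingberg 1989 Cor. 2.5 [Wingberg1989].
-/

set_option linter.dupNamespace false
set_option autoImplicit false

noncomputable section

open scoped Classical NumberField MatrixGroups ModularForm

open NumberField IsDedekindDomain CongruenceSubgroup WeierstrassCurve Field
  Literature.NumberTheory.EllipticCurves Literature.NumberTheory.EllipticCurves.ModularForms
  Literature.NumberTheory.EllipticCurves.ZpExtension Literature.NumberTheory.EllipticCurves.Sprung2017
  Literature.NumberTheory.EllipticCurves.Sprung2012 Literature.NumberTheory.EllipticCurves.Rank1Residual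
  Literature.NumberTheory.EllipticCurves.IwasawaAlgebra Literature.NumberTheory.EllipticCurves.Kato2004
  Literature.NumberTheory.EllipticCurves.Module
  Summit.BirchSwinnertonDyer.BirchSwinnertonDyer.Theorems

namespace Summit.BirchSwinnertonDyer.BirchSwinnertonDyer.Theorems.ChromaticCommonZeros

/-- **Crux 23401 BY NAME from four printed facts and the residue R♮.** Sprung's Poitou–Tate functional model (`hPT`), Kato Thm. 12.4
(`h124`), Matar 2020 Thm. 1.1 (`hMatar`), Kato's fine torsion (`hfine`) — BY NAME — give the F-α♮ stub of the ι-door pair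
(`cokerBoundIotaOffT_of_poitouTate`, with `Kato2004.nonempty_iwasawaH1Data_holds`); the crux's own guard `(h714, h716c, h3)` feeds the
residue hypothesis `hR` (= the registered stub `stub_katoFineLowerResidueIotaOffTC`'s ∀-body, displayed); the ι-door
`stubs_offT_of_iotaDoor` (p658197) composes; the conjuncts close by unfolding. CONDITIONAL; closes nothing. [cite: Sprung2012, Thm. 7.14 (3)
(p. 1504), Prop. 7.19 and Main Conj. 7.21 (p. 1505)] [cite: Kato2004Asterisque, Thm. 12.4 (p. 221), Conj. 12.10 (p. 224)] [cite: Matar2020, Thm. 1.1] -/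
theorem KatoSporadicPosLevelGivenHeldX8C_of_printedFacts_of_residue
    (hPT : thm714seq_sharpFlat_poitouTate_functionalModel) (h124 : Kato2004.thm12_4)
    (hMatar : matar2020_thm11_selmerDualTorsion_pseudoIso_fineSelmerDual) (hfine : Kato2004_fineSelmerDual_isTorsion)
    (hR : thm714_sharpFlatSelmerDual_finite_torsion → thm716_sharpFlatCharIdeal_divisibility_contra →
      realPeriodRat_eq_unit_mul_plusPeriod_three →
      ∀ (W : WeierstrassCurve ℚ) [W.IsElliptic] [W.IsGloballyMinimal] (p : ℕ) [Fact p.Prime]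
            [ContinuousSMul ℤ_[p] (W.tateModule p)] [Module.Free ℤ_[p] (W.tateModule p)]
            [Module.Finite ℤ_[p] (W.tateModule p)],
            ClassX8 W p → ∀ (κ : ZpExtension ℚ p) (γ : Field.absoluteGaloisGroup ℚ),
            κ.IsCyclotomic → κ.IsTopGenerator γ → IsCyclotomicVariable p γ →
          ∀ (v : HeightOneSpectrum (𝓞 ℚ)), (p : 𝓞 ℚ) ∈ v.asIdeal →
          ∀ (g : Field.absoluteGaloisGroup (v.adicCompletion ℚ)),
            κ.IsTopGenerator (resGalOfEmb (closureEmb (K := ℚ) (v.adicCompletion ℚ)) g) →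
          ∀ (cneg : localPoints W (v.adicCompletion ℚ)) (c : ℕ → localPoints W (v.adicCompletion ℚ)),
            IsHondaSystem κ (closureEmb (K := ℚ) (v.adicCompletion ℚ)) W (W.frobeniusTrace p) g cneg c →
          ∀ (N : ℕ) (_ : NeZero N) (f : CuspForm (Gamma0 N) 2) (ϖ : ℚ) (Lsharp Lflat : IwasawaAlgebra p),
            IsNewformOf W f → (ϖ : ℝ) * W.realPeriodRat = plusPeriod f →
            IsSprungPair f p (W.frobeniusTrace p) Lsharp Lflat →
          ∀ (I : Kato2004.IwasawaH1Data W p κ γ)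
            (Cs : SharpFlatColemanKatoData W p f ϖ κ γ (closureEmb (K := ℚ) (v.adicCompletion ℚ))
              (W.frobeniusTrace p) g c Chroma.sharp I)
            (Cf : SharpFlatColemanKatoData W p f ϖ κ γ (closureEmb (K := ℚ) (v.adicCompletion ℚ))
              (W.frobeniusTrace p) g c Chroma.flat I),
            Cs.Z = Cf.Z →
          ∀ (Y : W.FineSelmerDualData κ γ) (𝔭 : PrimeSpectrum (IwasawaAlgebra p)), 𝔭.asIdeal.height = 1 →
            (p : IwasawaAlgebra p) ∉ 𝔭.asIdeal → (PowerSeries.X : IwasawaAlgebra p) ∉ 𝔭.asIdeal →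
            (∀ (col' : Chroma) (G' : IwasawaAlgebra p),
              iwasawaToPowerSeries p G' =
                PowerSeries.C (ϖ : ℚ_[p]) * iwasawaToPowerSeries p (chromaticL col' Lsharp Lflat) →
              G' ∈ 𝔭.asIdeal) →
            min (Module.lengthAt (IwasawaAlgebra p) (IwasawaAlgebra p ⧸ LinearMap.range Cs.colMap)
                  (PrimeSpectrum.comap (invol p).toRingHom 𝔭))
                (Module.lengthAt (IwasawaAlgebra p) (IwasawaAlgebra p ⧸ LinearMap.range Cf.colMap)
                  (PrimeSpectrum.comap (invol p).toRingHom 𝔭)) <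
                Module.lengthAt (IwasawaAlgebra p) (I.H ⧸ Cs.Z) 𝔭 →
            Module.lengthAt (IwasawaAlgebra p) (I.H ⧸ Cs.Z) 𝔭 ≤ Module.lengthAt (IwasawaAlgebra p) Y.X 𝔭 ) :
    Summit.BirchSwinnertonDyer.BirchSwinnertonDyer.Theses.PrintX8VS.KatoSporadicPosLevelGivenHeldX8C := by
  intro h714 h716c h3
  have hFα := cokerBoundIotaOffT_of_poitouTate hPT h124 Kato2004.nonempty_iwasawaH1Data_holds hMatar hfine
  refine ⟨?_, ?_⟩
  · intro W _ _ p _ _ _ _ hX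
    exact (stubs_offT_of_iotaDoor hFα (hR h714 h716c h3)).1 W p hX
  · intro W _ _ p _ _ _ _ hX
    exact (stubs_offT_of_iotaDoor hFα (hR h714 h716c h3)).2 W p hX

end Summit.BirchSwinnertonDyer.BirchSwinnertonDyer.Theorems.ChromaticCommonZeros

end
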